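import Summits.ResolutionOfSingularities.ResolutionOfSingularities.Theorems.SubfieldContactClasses
import HarnessLib

/-!
# SubfieldContactFrames — decomp-res node «SubfieldContact» (lens-6 g19, critic rows 147/147b), tree file 2/5 of the node

Content VERBATIM from the decomp-res lens-6 g19 node file `HOME/decomp-res-lens-6/g19/SubfieldContact.lean` (rev 1
pin ba733ec4…, 855 l;
= `parts/SubfieldContact-g19-rev1-ba733ec4.lean`; HOME = run/shared/lean/pub/decomp-res).  Critic: CRITIC-LEDGER
rows 147 (node 90f156f3 CLEARED) and 147b
(rev 1 = MAP +1, window (M2) consumed; «rev 1 ba733ec4 SUPERSEDES 90f156f3 as the source of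
Theorems/SubfieldContactClasses», order 2026-08-30T22:19:25Z).
Landed by decomp-res writer g8 in the lens's namespace `…Theorems.SubfieldContactClasses`, split CONE-AWARE for
the 400-line limit: `SubfieldContactClasses`
(§1–§6), `SubfieldContactFrames` (§7), `SubfieldContactAbs` (§8–§9), `SubfieldContactPowAdjoin` (§10) are
OUTSIDE the Theses cone (the lens's cone import
`MaxContactCutTauLadder` is used only by the «…_of_items» / «…_of_pieces» up-links from the MaxContactCut
items, which live in the in-cone wiring file
`MaxContactCutSubfieldContact`).  All `--supports stmt-ResolutionOfSingularities-29273` (`RungOne` = `E 2 → E 1`).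
 Route bookkeeping (critic rows 147/147b):
ONE located-residual aside `E1NoSubDvd` (home `SubfieldContactClasses`) on 29273; the NEW LEMMA `SubfieldContactAbs`
(skeleton §9 BY NAME: stubs
`StalkSubfieldContactAbs` / `ContactSpreads` / `SubfieldContactGlue`, `PowAdjoinBase` PROVED by
`powAdjoinBase_holds`) is booked as the prover target (kind aside
under the NAMED-RUNG RULE — outside the cone of `closes`); `SubfieldContact` is its kernel corollary
(`subfieldContact_of_abs`) and is NOT served separately.

§7 the typed attack plan for `SubfieldContact`: `strOver`, `powAdjoin`, `IsPBasis` (+ `exists_isPBasis`),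
`IsStalkContactPt`; PIECE R PROVED
(`diffIdeal_le_of_isScalarTower`, `diffIdealSheaf_le_comp`, `appTop_comp_specMap`, `isContactPt_comp_specMap`,
`strOver_eq_comp`, `isContactPt_strOver_mono`,
`powAdjoin_mono`); the four pieces `StalkSubfieldContact` / `PowAdjoinBase` / `ContactSpreads` /
`SubfieldContactGlue` (statements) and the kernel
composition `subfieldContact_of_pieces`.  0 sorry.  Imports `SubfieldContactClasses`.  Cone-free.

[WRITER NOTE (decomp-res writer g8): section split only; namespace, opens, section variables and every declaration
exactly as in the lens (global
`set_option` dropped; the cone import replaced in the cone-free files by the cone-free `WeakOrderReduction`, already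
under `PurityValveClasses`).]

(Sources: EGAIV4 §16.8; Matsumura1987 §26, Thm 30.6; Giraud1975; EncinasVillamayor2000GoodPoints §4;
BierstoneGrigorievMilmanWlodarczyk2011 §3; CossartJannsenSaito2020 Thm 1.4; CossartPiltant2008I Thm 2.1;
Cossart2011WeakMaximalContact; CossartPiltant2019; Kollar2007 §3.9.)
-/

noncomputable section

namespace Summit.ResolutionOfSingularities.ResolutionOfSingularities.Theorems.SubfieldContactClasses

open CategoryTheory AlgebraicGeometry TopologicalSpace
open Literature.AlgebraicGeometry.Resolution
open Summit.ResolutionOfSingularities.ResolutionOfSingularities.Theorems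
open WeakOrderReduction ForcedTowerClasses PurityValveClasses

/-! ## §7 Typed attack plan for `SubfieldContact` (the prover's skeleton): structure maps over subfields,
RESTRICTION OF THE STRUCTURE FIELD PRESERVES CONTACT (PROVED), and the four remaining pieces with the
kernel-checked composition `subfieldContact_of_pieces` -/

/-- The structure map over a subfield `F ≤ k`: `Y → Spec k → Spec F`. DEFINITION (support). -/
noncomputable def strOver {k : Type} [Field k] {Y : Scheme.{0}} (g : Y ⟶ Spec (.of k)) (F : Subfield k) :
    Y ⟶ Spec (.of F) :=
  g ≫ Spec.map (CommRingCat.ofHom F.subtype)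

/-- `k^{(q)}(Λ)`: the subfield of `k` generated by all `q`-th powers and `Λ` (for `q = p^e` in characteristic `p` this is
`k^{q}(Λ)`). DEFINITION (support). -/
def powAdjoin (k : Type) [Field k] (q : ℕ) (Λ : Set k) : Subfield k :=
  Subfield.closure ((Set.range fun x : k => x ^ q) ∪ Λ)

/-- An ABSOLUTE `p`-BASIS of `k`: `p`-independent over `k^{(p)} = k^p(∅)` (tree `IsPIndependent`, Matsumura §26) and
generating `k` over it. DEFINITION (support). -/
def IsPBasis (p : ℕ) (k : Type) [Field k] (B : Set k) : Prop :=
  IsPIndependent (F := ↥(powAdjoin k p ∅)) p B ∧ IntermediateField.adjoin (↥(powAdjoin k p ∅)) B = ⊤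

/-- Every field of characteristic `p` has an absolute `p`-basis (tree `exists_isPIndependent_adjoin_eq_top`, Zorn).
(Sources: Matsumura1987, §26 Thm 26.5.) -/
theorem exists_isPBasis {p : ℕ} (hp : p.Prime) (k : Type) [Field k] [CharP k p] : ∃ B : Set k, IsPBasis p k B := by
  haveI : Fact p.Prime := ⟨hp⟩
  obtain ⟨Γ, hΓ, htop⟩ := exists_isPIndependent_adjoin_eq_top (↥(powAdjoin k p ∅)) (E := k) p
    (fun x => ⟨⟨x ^ p, Subfield.subset_closure (Set.mem_union_left _ ⟨x, rfl⟩)⟩, rfl⟩)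
  exact ⟨Γ, hΓ, htop⟩

/-- CONTACT AT THE STALK over the structure `f : Y → Spec F`: some element of `Diff^{≤ n-1}_{𝒪_{Y,y}/F}(𝓘_y)` lies in
`𝔪_y ∖ 𝔪_y²` (the stalk `F`-algebra structure is the tree's `stalkAlgebra`). DEFINITION (support). -/
def IsStalkContactPt {F : Type} [Field F] {Y : Scheme.{0}} (f : Y ⟶ Spec (.of F)) (I : Y.IdealSheafData) (n : ℕ)
    (y : Y) : Prop :=
  ∃ u ∈ (letI := stalkAlgebra (f.appTop.hom.comp (Scheme.ΓSpecIso (.of F)).inv.hom) y;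
      diffIdeal F (n - 1) (stalkIdeal I y)),
    u ∈ IsLocalRing.maximalIdeal (Y.presheaf.stalk y) ∧ u ∉ IsLocalRing.maximalIdeal (Y.presheaf.stalk y) ^ 2

/-! ### Restriction of the structure field preserves contact (PROVED) -/

/-- `Diff` relative to a smaller base is larger: for a tower `R → S → A`, `Diff^{≤ n}_{A/S}(I) ⊆ Diff^{≤ n}_{A/R}(I)`
(an `S`-linear differential operator is an `R`-linear one with the same commutators). [folklore] -/
theorem diffIdeal_le_of_isScalarTower (R S : Type*) {A : Type*} [CommRing R] [CommRing S] [CommRing A]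
    [Algebra R S] [Algebra S A] [Algebra R A] [IsScalarTower R S A] (n : ℕ) (I : Ideal A) :
    diffIdeal S n I ≤ diffIdeal R n I := by
  refine Ideal.span_mono ?_
  rintro x ⟨D, hD, f, hf, rfl⟩
  exact ⟨D.restrictScalars R, IsDiffOpLE.restrictScalars_of_isScalarTower R hD, f, hf, rfl⟩

/-- Sheaf level: composing the structure `φ : F → Γ(Y, 𝒪)` with `ι : F₀ → F` can only ENLARGE `Diff^{≤
n}(𝓘)`. [folklore] -/
theorem diffIdealSheaf_le_comp {F₀ F : Type} [Field F₀] [Field F] {Y : Scheme.{0}} (ι : F₀ →+* F)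
    (φ : F →+* Γ(Y, ⊤)) (n : ℕ) (I : Y.IdealSheafData) :
    diffIdealSheaf φ n I ≤ diffIdealSheaf (φ.comp ι) n I := by
  refine Scheme.IdealSheafData.ofIdeals_mono fun U => ?_
  letI : Algebra F Γ(Y, U) := sectionsAlgebra φ U
  letI : Algebra F₀ Γ(Y, U) := sectionsAlgebra (φ.comp ι) U
  letI : Algebra F₀ F := ι.toAlgebra
  haveI : IsScalarTower F₀ F Γ(Y, U) := IsScalarTower.of_algebraMap_eq fun c => rfl
  exact diffIdeal_le_of_isScalarTower F₀ F n (I.ideal U)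

/-- The structure ring map of a composite `Y → Spec F → Spec F₀` is the composite ring map. [folklore] -/
theorem appTop_comp_specMap {F₀ F : Type} [Field F₀] [Field F] {Y : Scheme.{0}} (ι : F₀ →+* F)
    (f : Y ⟶ Spec (.of F)) :
    (f ≫ Spec.map (CommRingCat.ofHom ι)).appTop.hom.comp (Scheme.ΓSpecIso (.of F₀)).inv.hom =
      (f.appTop.hom.comp (Scheme.ΓSpecIso (.of F)).inv.hom).comp ι := by
  have hnat := congrArg CommRingCat.Hom.hom (Scheme.ΓSpecIso_inv_naturality (CommRingCat.ofHom ι))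
  simp only [CommRingCat.hom_comp, CommRingCat.hom_ofHom] at hnat
  rw [Scheme.Hom.comp_appTop, CommRingCat.hom_comp, RingHom.comp_assoc, ← hnat, ← RingHom.comp_assoc]

/-- **Contact is inherited by every smaller structure field**: if `y` is an `F`-contact point for `f : Y → Spec F`, it is
an `F₀`-contact point for `Y → Spec F → Spec F₀`. [folklore] -/
theorem isContactPt_comp_specMap {F₀ F : Type} [Field F₀] [Field F] {Y : Scheme.{0}} (ι : F₀ →+* F)
    (f : Y ⟶ Spec (.of F)) (I : Y.IdealSheafData) (n : ℕ) (y : Y) (h : IsContactPt f I n y) :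
    IsContactPt (f ≫ Spec.map (CommRingCat.ofHom ι)) I n y := by
  obtain ⟨U, hy, u, hu, h1, h2⟩ := h
  refine ⟨U, hy, u, ?_, h1, h2⟩
  rw [appTop_comp_specMap]
  exact (Scheme.IdealSheafData.le_def.1 (diffIdealSheaf_le_comp ι _ (n - 1) I)) U hu

/-- Subfield form: `strOver g F₀` factors through `strOver g F` for `F₀ ≤ F`. [folklore] -/
theorem strOver_eq_comp {k : Type} [Field k] {Y : Scheme.{0}} (g : Y ⟶ Spec (.of k)) {F₀ F : Subfield k}
    (h : F₀ ≤ F) : strOver g F₀ = strOver g F ≫ Spec.map (CommRingCat.ofHom (Subfield.inclusion h)) := by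
  have hc : F₀.subtype = F.subtype.comp (Subfield.inclusion h) := RingHom.ext fun _ => rfl
  unfold strOver
  rw [Category.assoc, ← Spec.map_comp, ← CommRingCat.ofHom_comp, ← hc]

/-- **PIECE R (PROVED) · contact descends along `F₀ ≤ F ≤ k`.** [folklore] -/
theorem isContactPt_strOver_mono {k : Type} [Field k] {Y : Scheme.{0}} (g : Y ⟶ Spec (.of k)) {F₀ F : Subfield k}
    (h : F₀ ≤ F) (I : Y.IdealSheafData) (n : ℕ) (y : Y) (hc : IsContactPt (strOver g F) I n y) :
    IsContactPt (strOver g F₀) I n y := by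
  rw [strOver_eq_comp g h]
  exact isContactPt_comp_specMap _ _ I n y hc

/-- … in particular from the given structure `g` (= `strOver g ⊤` up to the isomorphism `k ≅ ⊤`) is NOT needed; what the
glue uses is monotonicity in `Λ`: `Λ₀ ⊆ Λ ⇒ k^{(q)}(Λ₀) ≤ k^{(q)}(Λ)`. [folklore] -/
theorem powAdjoin_mono (k : Type) [Field k] (q : ℕ) {Λ₀ Λ : Set k} (h : Λ₀ ⊆ Λ) : powAdjoin k q Λ₀ ≤ powAdjoin k q Λ :=
  Subfield.closure_mono (Set.union_subset_union_right _ h)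

/-! ### The four remaining pieces (statements) and the composition -/

/-- **PIECE L1 · `StalkSubfieldContact` — THE NEW CORE** (NODE-g19 §3 (1): generation 18's `p^e`-frame with constant lifts
on a cofinite adapted part of an absolute `p`-basis + Cartier cofiniteness + the unit-binomial linear part): for `p ∤ n`,
an absolute `p`-basis `B` of `k` and a CLOSED point `y` with `ord_y 𝓘 = n`, finitely many `b ∈ B` aside, `y` is a
contact point AT THE STALK over `k^{(p^n)}(B ∖ S)`. [UNDECIDED(kernel) · ATTACKABLE · inputs: g18 `isQFrame_frobSubring`,
`exists_isDiffOpLE_of_isQFrame`; tree `PIndependence`] -/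
def StalkSubfieldContact : Prop :=
  ∀ p : ℕ, p.Prime → ∀ n : ℕ, 1 ≤ n → ¬ p ∣ n → ∀ (k : Type) [Field k] [CharP k p] (Y : Scheme.{0})
    (g : Y ⟶ Spec (.of k)), IsBase Y g → ∀ I : Y.IdealSheafData, ∀ B : Set k, IsPBasis p k B →
      ∀ y : Y, IsClosed ({y} : Set Y) → idealOrder I y = ((n : ℕ) : ℕ∞) →
        ∃ S : Finset k, (↑S : Set k) ⊆ B ∧ IsStalkContactPt (strOver g (powAdjoin k (p ^ n) (B \ ↑S))) I n y

/-- **PIECE F · `PowAdjoinBase`** — finite codegree: for an absolute `p`-basis `B` and finite `S ⊆ B`, `[k :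
k^{(p^n)}(B ∖ S)]
≤ p^{n·|S|} < ∞`, so `Y → Spec k^{(p^n)}(B ∖ S)` is again separated, locally of finite type and quasi-compact.
[KNOWN-MOD-LIBRARY: `finrank_adjoin_le_pow_card` shape + Mathlib (finite ⇒ lft; compositions)] -/
def PowAdjoinBase : Prop :=
  ∀ p : ℕ, p.Prime → ∀ n : ℕ, 1 ≤ n → ∀ (k : Type) [Field k] [CharP k p] (Y : Scheme.{0}) (g : Y ⟶ Spec (.of k)),
    IsBase Y g → ∀ B : Set k, IsPBasis p k B → ∀ S : Finset k, (↑S : Set k) ⊆ B →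
      IsSeparated (strOver g (powAdjoin k (p ^ n) (B \ ↑S))) ∧
        LocallyOfFiniteType (strOver g (powAdjoin k (p ^ n) (B \ ↑S))) ∧
          QuasiCompact (strOver g (powAdjoin k (p ^ n) (B \ ↑S)))

/-- **PIECE L2 · `ContactSpreads`** (NODE-g19 §3 (2)–(3)): over a field `F` with `Y → Spec F` locally of finite type and
`Y` regular, contact AT THE STALK at a point `y` with `ord_y 𝓘 = n = max ord` spreads to SECTION-level contact at every
top point of an open neighbourhood of `y` (localisation of `Diff_{/F}` for finite-type algebras — tree
`stalkIdeal_diffIdealSheaf` —, then the open regular locus of `V(ũ)` on the component of `y`).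
[KNOWN-MOD-LIBRARY: `DiffIdealStalk`, `ExcellentRings` (J-2), order drop `IsDiffOpLE.apply_mem_pow_sub`] -/
def ContactSpreads : Prop :=
  ∀ (F : Type) [Field F] (Y : Scheme.{0}) (f : Y ⟶ Spec (.of F)), LocallyOfFiniteType f → Scheme.IsRegular Y →
    ∀ (I : Y.IdealSheafData) (n : ℕ), 1 ≤ n → (∀ y : Y, idealOrder I y ≤ ((n : ℕ) : ℕ∞)) →
      ∀ y : Y, idealOrder I y = ((n : ℕ) : ℕ∞) → IsStalkContactPt f I n y →
        ∃ U : Y.Opens, y ∈ U ∧ ∀ y' : Y, y' ∈ U → idealOrder I y' = ((n : ℕ) : ℕ∞) → IsContactPt f I n y'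

/-- **PIECE C · `SubfieldContactGlue`** (NODE-g19 §3 (4)–(5)): if every CLOSED top point has an open neighbourhood on
whose top points contact holds over `k^{(p^n)}(B ∖ S_y)` for some finite `S_y ⊆ B`, then the datum has subfield contact
(`Top` is closed and quasi-compact, closed points are dense in closed subsets of the Jacobson scheme `Y`, finitely many
`S_{yᵢ}`, `F := k^{(p^n)}(B ∖ ⋃ S_{yᵢ})`, PIECE R for `F ≤ k^{(p^n)}(B ∖ S_{yᵢ})`, PIECE F for the finiteness).
[KNOWN-MOD-LIBRARY: Mathlib Jacobson/quasi-compactness + `isContactPt_strOver_mono` + `PowAdjoinBase`] -/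
def SubfieldContactGlue : Prop :=
  ∀ p : ℕ, p.Prime → ∀ n : ℕ, 1 ≤ n → ∀ (k : Type) [Field k] [CharP k p] (Y : Scheme.{0}) (g : Y ⟶ Spec (.of k)),
    IsBase Y g → ∀ I : Y.IdealSheafData, (∀ y : Y, idealOrder I y ≤ ((n : ℕ) : ℕ∞)) → ∀ B : Set k, IsPBasis p k B →
      (∀ y : Y, IsClosed ({y} : Set Y) → idealOrder I y = ((n : ℕ) : ℕ∞) →
        ∃ S : Finset k, (↑S : Set k) ⊆ B ∧ ∃ U : Y.Opens, y ∈ U ∧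
          ∀ y' : Y, y' ∈ U → idealOrder I y' = ((n : ℕ) : ℕ∞) →
            IsContactPt (strOver g (powAdjoin k (p ^ n) (B \ ↑S))) I n y') →
      HasSubfieldContact p Y I n

/-- **THE COMPOSITION (kernel, 0 sorry)**: `StalkSubfieldContact → PowAdjoinBase → ContactSpreads →
SubfieldContactGlue →
SubfieldContact`.  The NEW content is `StalkSubfieldContact` (L1); F, L2, C are library-grade. [folklore] -/
theorem subfieldContact_of_pieces (hL1 : StalkSubfieldContact) (hF : PowAdjoinBase) (hL2 : ContactSpreads)
    (hC : SubfieldContactGlue) : SubfieldContact := by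
  intro p hp n hn hpn k _ _ Y g hB I hord
  obtain ⟨B, hBasis⟩ := exists_isPBasis hp k
  refine hC p hp n hn k Y g hB I hord B hBasis fun y hyc hy => ?_
  obtain ⟨S, hSB, hst⟩ := hL1 p hp n hn hpn k Y g hB I B hBasis y hyc hy
  obtain ⟨-, hlft, -⟩ := hF p hp n hn k Y g hB B hBasis S hSB
  obtain ⟨U, hyU, hU⟩ := hL2 (↥(powAdjoin k (p ^ n) (B \ ↑S))) Y (strOver g (powAdjoin k (p ^ n) (B \ ↑S))) hlft
    hB.isRegular I n hn hord y hy hst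
  exact ⟨S, hSB, U, hyU, hU⟩

end Summit.ResolutionOfSingularities.ResolutionOfSingularities.Theorems.SubfieldContactClasses
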